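import Mathlib
import HarnessLib
import Summits.HubbardSuperconductivity.HubbardSuperconductivity.Theorems.KLProgrammeKLRegimeSymbolFrameProfileThird

/-!
# Route `KLProgramme` — engine support, symbol layer at ORDER FOUR: the cutoff PROFILE at scale `n` with its first FOUR derivatives
# (`|Gₙ⁗| ≤ d e₀⁸/Λ_n⁸`), packaged as the complex `HasDerivAt` chain with increments that `Literature.Analysis.Calculus.CompIncrementChain` consumes

Cell `gate-hubbard-kl`, seat hubbard-kl-k3c3-p2 (g10); brick (D1c) of the «(c-D)² FAMILY TELESCOPE» (located finding «(b)-Wt-FAMILY-DEEP», evidence #55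
on stmt-HubbardSuperconductivity-20437, CD-FAMILY.md): the INCREMENT of a sector multiplier between two consecutive flow frames is
`Gₙ(k₀² + (e−ν)²) − Gₙ(k₀² + e²)` with `Gₙ(u) = bgmCutoffSq e₀ (16ⁿu)` the radial profile; its third differences along a grid line are those of
`Gₙ∘(U+W) − Gₙ∘U` (`U = k₀² + e²`, `W = −2eν + ν²`) and need the profile's jets to order three, their increments (hence order four) and the
vanishing of every jet above `Λ_n²` (support localisation `|e| ≤ Λ_n`).  Order-four supplement of p3's `…SymbolFrameProfileThird`:

* `exists_abs_derivs4_bgmCutoffSq_le` — `∃ d ≥ 0` bounding `|bgmCutoffSq′|, …, |bgmCutoffSq⁗|` globally;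
* `scaleProfile_bounds₄` — `|Gₙ⁗| ≤ d e₀⁸/Λ_n⁸` on top of `scaleProfile_bounds₃`;
* `scaleProfile_iteratedDeriv_eq_zero` — `Gₙ^{(k)}(u) = 0` for `u > Λ_n²` (every `k`);
* **`scaleProfile_chain₄`** — with `g_k u := (Gₙ^{(k)}(u) : ℂ)`: `HasDerivAt (g_k) (g_{k+1} u) u` (`k ≤ 3`), `‖g_k‖ ≤ d e₀^{2k}/Λ_n^{2k}` (`1 ≤ k ≤ 4`),
  `‖g₀‖ ≤ 1`, increments `‖g_k(x+y) − g_k(x)‖ ≤ (d e₀^{2k+2}/Λ_n^{2k+2})·|y|` (`k ≤ 3`) — exactly the outer-function hypotheses of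
  `hasDerivAt_comp_incr_chain` / `norm_comp_incr_deriv3_le` / `norm_fwdDiff_iter_three_comp_incr_le`.

Everything is proved; no definitions, no named facts.  Nothing asserts superconductivity. [cite: BenfattoGiulianiMastropietro2006, §2.3 (2.19), §2.5 (2.53), §3 (3.2)]
-/

noncomputable section

namespace Summit.HubbardSuperconductivity.HubbardSuperconductivity.Theorems.TorusFourierL2

set_option linter.dupNamespace false -- summit = problem name (single-conjunct summit), D-0017

open Set Filter Topology Literature.MathematicalPhysics.QuantumLattice Literature.MathematicalPhysics.QuantumLattice.FermiRG
open Literature.Probability.LatticeModels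
open Summit.HubbardSuperconductivity.HubbardSuperconductivity.Theorems.KLRegimeSplit
open Summit.HubbardSuperconductivity.HubbardSuperconductivity.Theorems.KLProgrammeLegKernels

/-! ### §1 The surrogate's first four derivatives are globally bounded -/

/-- **The first four derivatives of the surrogate are globally bounded**: `∃ d ≥ 0, |bgmCutoffSq^{(k)}| ≤ d` for `k = 1, …, 4`
(they vanish off the compact transition interval `[e₀²/16, e₀²]` and are continuous). [cite: BenfattoGiulianiMastropietro2006, §2.3 (2.19)] -/
theorem exists_abs_derivs4_bgmCutoffSq_le {e₀ : ℝ} (he : 0 < e₀) :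
    ∃ d : ℝ, 0 ≤ d ∧ (∀ u, |deriv (bgmCutoffSq e₀) u| ≤ d) ∧ (∀ u, |iteratedDeriv 2 (bgmCutoffSq e₀) u| ≤ d) ∧
      (∀ u, |iteratedDeriv 3 (bgmCutoffSq e₀) u| ≤ d) ∧ (∀ u, |iteratedDeriv 4 (bgmCutoffSq e₀) u| ≤ d) := by
  have hC : ∀ m : ℕ, ContDiff ℝ m (bgmCutoffSq e₀) := fun m => contDiff_bgmCutoffSq he
  have hvan : ∀ (m : ℕ), 1 ≤ m → ∀ u, (u < e₀ ^ 2 / 16 ∨ e₀ ^ 2 < u) → iteratedDeriv m (bgmCutoffSq e₀) u = 0 := by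
    intro m hm u hu
    rcases hu with hu | hu
    · have hev : bgmCutoffSq e₀ =ᶠ[𝓝 u] fun _ => (1 : ℝ) := by
        filter_upwards [Iio_mem_nhds hu] with v hv using (bgmCutoffSq_eq_const he).1 hv
      rw [hev.iteratedDeriv_eq, iteratedDeriv_const]; simp [show m ≠ 0 by omega]
    · have hev : bgmCutoffSq e₀ =ᶠ[𝓝 u] fun _ => (0 : ℝ) := by
        filter_upwards [Ioi_mem_nhds hu] with v hv using (bgmCutoffSq_eq_const he).2 hv
      rw [hev.iteratedDeriv_eq, iteratedDeriv_const]; simp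
  have hbd : ∀ m : ℕ, 1 ≤ m → ∃ C, 0 ≤ C ∧ ∀ u, |iteratedDeriv m (bgmCutoffSq e₀) u| ≤ C := by
    intro m hm
    have hcont : Continuous (iteratedDeriv m (bgmCutoffSq e₀)) := (hC m).continuous_iteratedDeriv' m
    obtain ⟨C, hC'⟩ := (isCompact_Icc (a := e₀ ^ 2 / 16) (b := e₀ ^ 2)).exists_bound_of_continuousOn hcont.continuousOn
    refine ⟨max C 0, le_max_right _ _, fun u => ?_⟩
    by_cases hu : u ∈ Icc (e₀ ^ 2 / 16) (e₀ ^ 2)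
    · exact ((Real.norm_eq_abs _).symm.le.trans (hC' u hu)).trans (le_max_left _ _)
    · rw [mem_Icc, not_and_or, not_le, not_le] at hu
      rw [hvan m hm u hu, abs_zero]; exact le_max_right _ _
  obtain ⟨C₁, hC₁0, hC₁⟩ := hbd 1 le_rfl
  obtain ⟨C₂, -, hC₂⟩ := hbd 2 (by norm_num)
  obtain ⟨C₃, -, hC₃⟩ := hbd 3 (by norm_num)
  obtain ⟨C₄, -, hC₄⟩ := hbd 4 (by norm_num)
  refine ⟨max (max (max C₁ C₂) C₃) C₄, le_max_of_le_left (le_max_of_le_left (le_max_of_le_left hC₁0)),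
    fun u => ?_, fun u => ?_, fun u => ?_, fun u => ?_⟩
  · have h := hC₁ u
    rw [iteratedDeriv_one] at h
    exact h.trans ((le_max_left _ _).trans ((le_max_left _ _).trans (le_max_left _ _)))
  · exact (hC₂ u).trans ((le_max_right _ _).trans ((le_max_left _ _).trans (le_max_left _ _)))
  · exact (hC₃ u).trans ((le_max_right _ _).trans (le_max_left _ _))
  · exact (hC₄ u).trans (le_max_right _ _)

/-! ### §2 The rescaled profile of scale `n` at order four; vanishing of all jets above `Λ_n²` -/

/-- **Order four**: `|Gₙ⁗(u)| ≤ d e₀⁸/Λ_n⁸` for `Gₙ(u) = bgmCutoffSq e₀ (16ⁿ u)` and `d ≥ |bgmCutoffSq⁗|`. [cite: BenfattoGiulianiMastropietro2006, §2.3 (2.19)] -/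
theorem scaleProfile_bounds₄ {e₀ : ℝ} (he : 0 < e₀) (n : ℕ) {d : ℝ} (hd4 : ∀ u, |iteratedDeriv 4 (bgmCutoffSq e₀) u| ≤ d) (u : ℝ) :
    |iteratedDeriv 4 (fun u => bgmCutoffSq e₀ ((16 : ℝ) ^ n * u)) u| ≤ d * e₀ ^ 8 / klScale e₀ n ^ 8 := by
  have hC : ContDiff ℝ 4 (bgmCutoffSq e₀) := contDiff_bgmCutoffSq he
  have h16 : (16 : ℝ) ^ n = e₀ ^ 2 / klScale e₀ n ^ 2 := sixteen_pow_eq n he.ne'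
  rw [iteratedDeriv_comp_const_mul hC, abs_mul, abs_of_pos (by positivity : (0 : ℝ) < ((16 : ℝ) ^ n) ^ 4)]
  calc ((16 : ℝ) ^ n) ^ 4 * |iteratedDeriv 4 (bgmCutoffSq e₀) ((16 : ℝ) ^ n * u)| ≤ ((16 : ℝ) ^ n) ^ 4 * d :=
        mul_le_mul_of_nonneg_left (hd4 _) (by positivity)
    _ = d * e₀ ^ 8 / klScale e₀ n ^ 8 := by rw [h16]; ring

/-- **All jets of the scale-`n` profile vanish above `Λ_n²`**: `Gₙ^{(k)}(u) = 0` for `u > Λ_n²` (`Gₙ ≡ 0` on the open half-line).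
[cite: BenfattoGiulianiMastropietro2006, §2.5 (2.53)] -/
theorem scaleProfile_iteratedDeriv_eq_zero {e₀ : ℝ} (he : 0 < e₀) (n k : ℕ) {u : ℝ} (hu : klScale e₀ n ^ 2 < u) :
    iteratedDeriv k (fun u => bgmCutoffSq e₀ ((16 : ℝ) ^ n * u)) u = 0 := by
  have hΛ : 0 < klScale e₀ n := by rw [klScale]; positivity
  have h16 : (16 : ℝ) ^ n = e₀ ^ 2 / klScale e₀ n ^ 2 := sixteen_pow_eq n he.ne'
  have hzero : ∀ v, klScale e₀ n ^ 2 < v → bgmCutoffSq e₀ ((16 : ℝ) ^ n * v) = 0 := by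
    intro v hv
    refine (bgmCutoffSq_eq_const he).2 ?_
    rw [h16]
    have hΛ2 : 0 < klScale e₀ n ^ 2 := by positivity
    have he2 : 0 < e₀ ^ 2 := by positivity
    rw [div_mul_eq_mul_div, lt_div_iff₀ hΛ2]
    nlinarith [mul_lt_mul_of_pos_left hv he2]
  have hev : (fun u => bgmCutoffSq e₀ ((16 : ℝ) ^ n * u)) =ᶠ[𝓝 u] fun _ => (0 : ℝ) := by
    filter_upwards [Ioi_mem_nhds hu] with v hv using hzero v hv
  rw [hev.iteratedDeriv_eq, iteratedDeriv_const]; simp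

/-! ### §3 The complex `HasDerivAt` chain with increments (the outer-function block of `CompIncrementChain`) -/

/-- **The scale-`n` profile as an outer function with bounded jets and increments**: with `Gₙ(u) = bgmCutoffSq e₀ (16ⁿ u)`, `Λ = klScale e₀ n`,
`d ≥ |bgmCutoffSq^{(k)}|` (`k ≤ 4`) and `g_k := (Gₙ^{(k)} : ℝ → ℂ)`: the `HasDerivAt` links `g₀ → g₁ → g₂ → g₃ → g₄`, the bounds `‖g₀‖ ≤ 1`,
`‖g_k‖ ≤ d e₀^{2k}/Λ^{2k}` (`k = 1..4`) and the increments `‖g_k(x+y) − g_k(x)‖ ≤ (d e₀^{2k+2}/Λ^{2k+2})|y|` (`k = 0..3`).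
[cite: BenfattoGiulianiMastropietro2006, §2.3 (2.19), §3 (3.2)] -/
theorem scaleProfile_chain₄ {e₀ : ℝ} (he : 0 < e₀) (n : ℕ) {d : ℝ} (hd1 : ∀ u, |deriv (bgmCutoffSq e₀) u| ≤ d)
    (hd2 : ∀ u, |iteratedDeriv 2 (bgmCutoffSq e₀) u| ≤ d) (hd3 : ∀ u, |iteratedDeriv 3 (bgmCutoffSq e₀) u| ≤ d)
    (hd4 : ∀ u, |iteratedDeriv 4 (bgmCutoffSq e₀) u| ≤ d) :
    (∀ k ≤ 3, ∀ u, HasDerivAt (fun u => ((iteratedDeriv k (fun u => bgmCutoffSq e₀ ((16 : ℝ) ^ n * u)) u : ℝ) : ℂ))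
      ((iteratedDeriv (k + 1) (fun u => bgmCutoffSq e₀ ((16 : ℝ) ^ n * u)) u : ℝ) : ℂ) u) ∧
    (∀ u, ‖((iteratedDeriv 0 (fun u => bgmCutoffSq e₀ ((16 : ℝ) ^ n * u)) u : ℝ) : ℂ)‖ ≤ 1) ∧
    (∀ u, ‖((iteratedDeriv 1 (fun u => bgmCutoffSq e₀ ((16 : ℝ) ^ n * u)) u : ℝ) : ℂ)‖ ≤ d * e₀ ^ 2 / klScale e₀ n ^ 2) ∧
    (∀ u, ‖((iteratedDeriv 2 (fun u => bgmCutoffSq e₀ ((16 : ℝ) ^ n * u)) u : ℝ) : ℂ)‖ ≤ d * e₀ ^ 4 / klScale e₀ n ^ 4) ∧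
    (∀ u, ‖((iteratedDeriv 3 (fun u => bgmCutoffSq e₀ ((16 : ℝ) ^ n * u)) u : ℝ) : ℂ)‖ ≤ d * e₀ ^ 6 / klScale e₀ n ^ 6) ∧
    (∀ u, ‖((iteratedDeriv 4 (fun u => bgmCutoffSq e₀ ((16 : ℝ) ^ n * u)) u : ℝ) : ℂ)‖ ≤ d * e₀ ^ 8 / klScale e₀ n ^ 8) ∧
    (∀ x y, ‖((iteratedDeriv 0 (fun u => bgmCutoffSq e₀ ((16 : ℝ) ^ n * u)) (x + y) : ℝ) : ℂ) -
      ((iteratedDeriv 0 (fun u => bgmCutoffSq e₀ ((16 : ℝ) ^ n * u)) x : ℝ) : ℂ)‖ ≤ d * e₀ ^ 2 / klScale e₀ n ^ 2 * |y|) ∧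
    (∀ x y, ‖((iteratedDeriv 1 (fun u => bgmCutoffSq e₀ ((16 : ℝ) ^ n * u)) (x + y) : ℝ) : ℂ) -
      ((iteratedDeriv 1 (fun u => bgmCutoffSq e₀ ((16 : ℝ) ^ n * u)) x : ℝ) : ℂ)‖ ≤ d * e₀ ^ 4 / klScale e₀ n ^ 4 * |y|) ∧
    (∀ x y, ‖((iteratedDeriv 2 (fun u => bgmCutoffSq e₀ ((16 : ℝ) ^ n * u)) (x + y) : ℝ) : ℂ) -
      ((iteratedDeriv 2 (fun u => bgmCutoffSq e₀ ((16 : ℝ) ^ n * u)) x : ℝ) : ℂ)‖ ≤ d * e₀ ^ 6 / klScale e₀ n ^ 6 * |y|) ∧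
    (∀ x y, ‖((iteratedDeriv 3 (fun u => bgmCutoffSq e₀ ((16 : ℝ) ^ n * u)) (x + y) : ℝ) : ℂ) -
      ((iteratedDeriv 3 (fun u => bgmCutoffSq e₀ ((16 : ℝ) ^ n * u)) x : ℝ) : ℂ)‖ ≤ d * e₀ ^ 8 / klScale e₀ n ^ 8 * |y|) := by
  set G : ℝ → ℝ := (fun u => bgmCutoffSq e₀ ((16 : ℝ) ^ n * u)) with hG
  set Λ := klScale e₀ n with hΛ
  obtain ⟨hC3, h0, h1, h2, h3, -⟩ := scaleProfile_bounds₃ he n hd1 hd2 hd3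
  have h4 : ∀ u, |iteratedDeriv 4 G u| ≤ d * e₀ ^ 8 / Λ ^ 8 := fun u => scaleProfile_bounds₄ he n hd4 u
  have hC : ContDiff ℝ 4 G := (contDiff_bgmCutoffSq he).comp (contDiff_const.mul contDiff_id)
  -- real `HasDerivAt` links of the iterated derivatives
  have hlink : ∀ k ≤ 3, ∀ u, HasDerivAt (iteratedDeriv k G) (iteratedDeriv (k + 1) G u) u := by
    intro k hk u
    have hdiff : Differentiable ℝ (iteratedDeriv k G) :=
      hC.differentiable_iteratedDeriv k (by exact_mod_cast (show k < 4 by omega))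
    have h := (hdiff u).hasDerivAt
    rwa [← iteratedDeriv_succ] at h
  have hlinkC : ∀ k ≤ 3, ∀ u, HasDerivAt (fun u => ((iteratedDeriv k G u : ℝ) : ℂ)) ((iteratedDeriv (k + 1) G u : ℝ) : ℂ) u :=
    fun k hk u => (hlink k hk u).ofReal_comp
  -- norms
  have nrm : ∀ (f : ℝ → ℝ) (C : ℝ), (∀ u, |f u| ≤ C) → ∀ u, ‖((f u : ℝ) : ℂ)‖ ≤ C := fun f C hf u => by
    rw [Complex.norm_real, Real.norm_eq_abs]; exact hf u
  have n0 : ∀ u, ‖((iteratedDeriv 0 G u : ℝ) : ℂ)‖ ≤ 1 := by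
    intro u; rw [iteratedDeriv_zero]; exact nrm G 1 h0 u
  have n1 : ∀ u, ‖((iteratedDeriv 1 G u : ℝ) : ℂ)‖ ≤ d * e₀ ^ 2 / Λ ^ 2 := by
    intro u; rw [iteratedDeriv_one]; exact nrm _ _ h1 u
  have n2 : ∀ u, ‖((iteratedDeriv 2 G u : ℝ) : ℂ)‖ ≤ d * e₀ ^ 4 / Λ ^ 4 := nrm _ _ h2
  have n3 : ∀ u, ‖((iteratedDeriv 3 G u : ℝ) : ℂ)‖ ≤ d * e₀ ^ 6 / Λ ^ 6 := nrm _ _ h3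
  have n4 : ∀ u, ‖((iteratedDeriv 4 G u : ℝ) : ℂ)‖ ≤ d * e₀ ^ 8 / Λ ^ 8 := nrm _ _ h4
  -- increments by the mean value inequality
  have incr : ∀ k ≤ 3, ∀ C, (∀ u, ‖((iteratedDeriv (k + 1) G u : ℝ) : ℂ)‖ ≤ C) →
      ∀ x y, ‖((iteratedDeriv k G (x + y) : ℝ) : ℂ) - ((iteratedDeriv k G x : ℝ) : ℂ)‖ ≤ C * |y| := by
    intro k hk C hCb x y
    have h := Convex.norm_image_sub_le_of_norm_hasDerivWithin_le (s := univ) (f := fun u => ((iteratedDeriv k G u : ℝ) : ℂ))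
      (f' := fun u => ((iteratedDeriv (k + 1) G u : ℝ) : ℂ)) (C := C)
      (fun z _ => (hlinkC k hk z).hasDerivWithinAt) (fun z _ => hCb z) convex_univ (mem_univ x) (mem_univ (x + y))
    simpa [Real.norm_eq_abs] using h
  refine ⟨hlinkC, n0, n1, n2, n3, n4, incr 0 (by norm_num) _ n1, incr 1 (by norm_num) _ n2, incr 2 (by norm_num) _ n3,
    incr 3 le_rfl _ n4⟩

end Summit.HubbardSuperconductivity.HubbardSuperconductivity.Theorems.TorusFourierL2

end
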